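import Literature.AlgebraicGeometry.Resolution.Lipman1969NegativeDefiniteHolds
import Literature.AlgebraicGeometry.Resolution.Lipman1969ClosedPointHolds
import Literature.AlgebraicGeometry.Resolution.ExceptionalPointsFinite
import Literature.AlgebraicGeometry.Resolution.ExceptionalCurvePoints
import HarnessLib

/-!
# A non-zero effective exceptional divisor meets one of ITS OWN components negatively
# (corollary of du Val negative definiteness, Lipman 1969 Lemma (14.1); Artin's fundamental-cycle argument)

Topic: `Literature/AlgebraicGeometry/Resolution`.  PROVED, no named facts.  For a desingularization
`π : X → Spec T` of a two-dimensional normal Noetherian local domain and an effective Cartier divisor `D` on `X`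
supported on the closed fibre (it avoids every point off the closed fibre) and non-zero (it does not avoid some
point), there is an integral exceptional curve `E_η` **contained in the support of `D`** (`ord_η D > 0`) with
`(𝒪_X(D)·E_η) < 0`.  This is the step «`Z > 0` exceptional ⇒ `(Z²) < 0` ⇒ `(Z·E_i) < 0` for some component `E_i`
of `Z`» of Artin's construction of the fundamental cycle (Artin 1966, p. 131–132) and of every computation-sequence
argument; it rests only on the negative definiteness of `((E_i·E_j))` (du Val; Mumford 1961; Lipman 1969, Lemma
(14.1) — the tree theorem `Lipman1969_14_1_holds`).

* `exists_ordAt_pos_and_excCurveDegree_neg_of_isEffective` — the statement above (support language,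
  `CartierDivisor.Avoids`);
* `exists_ordAt_pos_and_excCurveDegree_neg_of_charts` — the same with the hypotheses on the local equations `f_i`.

Proof: write the Weil cycle of `D` as `N = Σ_η a_η [E_η]` over the (finite, `excPoints_finite`) integral exceptional
curves, `a_η = ord_η D ≥ 0`; every codimension-one point of the closed fibre is such an `η`
(`IsResolution.mem_excCurvePoints_or_isClosed`, `Lipman1969_14_closedPoint_holds`) and `ord_η [E_η] = 1`
(`ordAt_ofIsEffectiveCartier_primeDivisorIdeal_self`), so `D` and `N` are the same divisor on the regular `X`
(`CartierDivisor.sameDivisor_of_forall_ordAt_eq`) and `(D·E_i) = Σ_j a_j (E_j·E_i)`; `a ≠ 0` (else `D ∼ 0` avoids every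
point); negative definiteness gives `Σ_i a_i (D·E_i) < 0`, so some term `a_i (D·E_i)` is negative, i.e. `a_i > 0` and
`(D·E_i) < 0`.  (The summit-side file `Summits/…/Theorems/HomologicalConductorNoZenoPNonemptyNegDef` has the weaker
conclusion without `ord_η D > 0`; this is its Literature home and sharpening.)

## References
* J. Lipman, *Rational singularities, with applications to algebraic surfaces and unique factorization*, Publ. Math.
  IHÉS 36 (1969), §14, Lemma (14.1) (p. 224). [Lipman1969]
* M. Artin, *On isolated rational singularities of surfaces*, Amer. J. Math. 88 (1966), pp. 131–132 (fundamental
  cycle). [Artin1966]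
* D. Mumford, Publ. Math. IHÉS 9 (1961), p. 6.
-/

noncomputable section

open CategoryTheory AlgebraicGeometry TopologicalSpace IsLocalRing Order
open Literature.AlgebraicGeometry.Motives Literature.AlgebraicGeometry.Motives.RatFn

universe u

namespace Literature.AlgebraicGeometry.Resolution

variable {T : Type u} [CommRing T] [IsNoetherianRing T] [IsLocalRing T] [IsDomain T] [IsIntegrallyClosed T]
  {X : Scheme.{u}} [IsIntegral X] [IsLocallyNoetherian X] {π : X ⟶ Spec (.of T)}

/-- **A non-zero effective exceptional divisor meets one of its own components negatively.**  Let `T` be a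
Noetherian normal local domain of Krull dimension `2`, `π : X → Spec T` a resolution (proper, birational, `X` regular),
and `D ≥ 0` a Cartier divisor on `X` which avoids every point off the closed fibre and does not avoid some point.
Then there is an integral exceptional curve `E_η` with `ord_η D > 0` and `(𝒪_X(D)·E_η) < 0` (du Val negative
definiteness applied to the Weil cycle of `D`; Artin's fundamental-cycle step).
[cite: Lipman1969, Lemma (14.1) (p. 224)] -/
theorem exists_ordAt_pos_and_excCurveDegree_neg_of_isEffective (hdim : ringKrullDim T = 2)
    (hπ : IsResolution π)
    (D : CartierDivisor X) (hD : D.IsEffective)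
    (hoff : ∀ x : X, π.base x ≠ closedPoint T → D.Avoids x) (hx₀ : ∃ x₀ : X, ¬ D.Avoids x₀) :
    ∃ η ∈ excCurvePoints π, 0 < D.ordAt η ∧ excCurveDegree π D η < 0 := by
  classical
  haveI : IsProper π := hπ.isProper
  have hX : Scheme.IsRegular X := hπ.isRegular
  -- the finite family of ALL integral exceptional curves
  have hfin : (excCurvePoints π).Finite :=
    (excPoints_finite π).subset (hπ.excCurvePoints_subset_excPoints hdim)
  set F : Finset X := hfin.toFinset with hFdef
  have hF : ∀ η ∈ F, η ∈ excCurvePoints π := fun η h => hfin.mem_toFinset.mp h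
  have hη : ∀ i : {η // η ∈ F}, (i : X) ∈ excCurvePoints π := fun i => hF i i.2
  have hco : ∀ i : {η // η ∈ F}, coheight (i : X) = 1 := fun i =>
    hπ.coheight_eq_one_of_mem_excCurvePoints hdim (hη i)
  have hc : ∀ η ∈ F, IsEffectiveCartier (primeDivisorIdeal η) := fun η h =>
    isEffectiveCartier_primeDivisorIdeal_of_isRegular hX (hπ.coheight_eq_one_of_mem_excCurvePoints hdim (hF η h))
  -- every codimension-one point of the closed fibre is one of them
  have hmemF : ∀ z : X, coheight z = 1 → π.base z = closedPoint T → z ∈ F := by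
    intro z hz hzm
    rcases hπ.mem_excCurvePoints_or_isClosed hdim hzm with h | h
    · exact hfin.mem_toFinset.mpr h
    · exfalso
      have h2 := Lipman1969_14_closedPoint_holds T hdim X π hπ z h
      rw [hz] at h2
      exact absurd h2 (by decide)
  -- the prime divisors `E_j`
  set E : {η // η ∈ F} → CartierDivisor X := fun j =>
    CartierDivisor.ofIsEffectiveCartier (primeDivisorIdeal (j : X)) (hc j j.2) with hEdef
  have hEself : ∀ j : {η // η ∈ F}, (E j).ordAt j = 1 := fun j =>
    ordAt_ofIsEffectiveCartier_primeDivisorIdeal_self hX (hco j) (hc j j.2)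
  have hEav : ∀ (j : {η // η ∈ F}) (z : X), ¬ (j : X) ⤳ z → (E j).Avoids z := fun j z hz =>
    (CartierDivisor.avoids_ofIsEffectiveCartier_iff _ (hc j j.2) z).2 (by rwa [mem_support_primeDivisorIdeal_iff])
  -- distinct codimension-one points do not specialise to one another
  have hnsp : ∀ z w : X, coheight z = 1 → coheight w = 1 → z ≠ w → ¬ z ⤳ w := by
    intro z w hz hw hne hsp
    have hlt : w < z := ⟨Scheme.le_iff_specializes.2 hsp,
      fun h' => hne (((Scheme.le_iff_specializes.1 h').antisymm hsp).eq).symm⟩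
    have h1 := Order.coheight_add_one_le hlt
    rw [hz, hw] at h1
    exact absurd h1 (by decide)
  have hEoff : ∀ (j : {η // η ∈ F}) (z : X), coheight z = 1 → z ≠ (j : X) → (E j).ordAt z = 0 :=
    fun j z hz hne => (hEav j z (hnsp (j : X) z (hco j) hz (Ne.symm hne))).ordAt_eq_zero
  have hEoff' : ∀ i j : {η // η ∈ F}, i ≠ j → (E j).ordAt i = 0 := fun i j hij =>
    hEoff j i (hco i) fun h => hij (Subtype.ext h)
  -- off the closed fibre every `E_j` has order `0`
  have hEgen : ∀ (j : {η // η ∈ F}) (z : X), π.base z ≠ closedPoint T → (E j).ordAt z = 0 := by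
    intro j z hz
    refine (hEav j z fun hsp => hz ?_).ordAt_eq_zero
    exact base_eq_closedPoint_of_specializes π (hη j).1 hsp
  -- the coefficients `a_j = ord_j D ≥ 0`
  set a : {η // η ∈ F} → ℕ := fun j => (D.ordAt j).toNat with hadef
  have haZ : ∀ j, (a j : ℤ) = D.ordAt j := fun j => Int.toNat_of_nonneg (hD.ordAt_nonneg _)
  -- finite sums of divisors as iterated sums: orders, degrees
  have hfold_ord : ∀ (l : List (CartierDivisor X)) (z : X),
      (l.foldr (· + ·) 0).ordAt z = (l.map fun D => D.ordAt z).sum := by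
    intro l z
    induction l with
    | nil => simp [CartierDivisor.ordAt_zero]
    | cons D l ih => simp [List.foldr_cons, CartierDivisor.ordAt_add, ih]
  have hfold_deg : ∀ (l : List (CartierDivisor X)) (i : {η // η ∈ F}),
      excCurveDegree π (l.foldr (· + ·) 0) i = (l.map fun D => excCurveDegree π D i).sum := by
    intro l i
    induction l with
    | nil => simp [excCurveDegree_zero π (hη i)]
    | cons D l ih => simp [List.foldr_cons, excCurveDegree_add π (hη i), ih]
  -- the Weil cycle `N = Σ_j a_j [E_j]` of `D`, as a Cartier divisor
  let N : CartierDivisor X :=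
    ((Finset.univ : Finset {η // η ∈ F}).toList.map fun j => a j • E j).foldr (· + ·) 0
  have hNord : ∀ z : X, N.ordAt z = ∑ j, (a j : ℤ) * (E j).ordAt z := by
    intro z
    simp only [N, hfold_ord, List.map_map]
    rw [← Finset.sum_map_toList (Finset.univ : Finset {η // η ∈ F})]
    congr 1
    refine List.map_congr_left fun j _ => ?_
    simp [CartierDivisor.ordAt_smul]
  have hNdeg : ∀ i : {η // η ∈ F}, excCurveDegree π N i = ∑ j, (a j : ℤ) * excCurveDegree π (E j) i := by
    intro i
    simp only [N, hfold_deg, List.map_map]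
    rw [← Finset.sum_map_toList (Finset.univ : Finset {η // η ∈ F})]
    congr 1
    refine List.map_congr_left fun j _ => ?_
    simp [excCurveDegree_smul π (hη i)]
  -- `D` and `N` have the same order at every codimension-one point, hence are the same divisor
  have hsame : D.SameDivisor N := by
    refine CartierDivisor.sameDivisor_of_forall_ordAt_eq hX fun z hz => ?_
    rw [hNord]
    by_cases hzm : π.base z = closedPoint T
    · have hzF : z ∈ F := hmemF z hz hzm
      rw [Finset.sum_eq_single_of_mem (⟨z, hzF⟩ : {η // η ∈ F}) (Finset.mem_univ _)
        fun j _ hj => by rw [hEoff j z hz (fun h => hj (Subtype.ext h).symm), mul_zero]]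
      change D.ordAt z = (a ⟨z, hzF⟩ : ℤ) * (E ⟨z, hzF⟩).ordAt z
      rw [hEself ⟨z, hzF⟩, mul_one, haZ]
    · rw [(hoff z hzm).ordAt_eq_zero]
      exact (Finset.sum_eq_zero fun j _ => by rw [hEgen j z hzm, mul_zero]).symm
  -- `(D·E_i) = Σ_j a_j (E_j·E_i)`
  have hdegD : ∀ i : {η // η ∈ F},
      excCurveDegree π D i = ∑ j, (a j : ℤ) * excCurveDegree π (E j) i := fun i => by
    rw [excCurveDegree_congr_linEquiv π (hη i) hsame.linEquiv, hNdeg]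
  -- `a ≠ 0`: otherwise `D ∼ 0` avoids every point
  have ha0 : (fun j => (a j : ℤ)) ≠ 0 := by
    intro h0
    obtain ⟨x₀, hx₀⟩ := hx₀
    apply hx₀
    have hD0 : D.SameDivisor 0 := by
      refine CartierDivisor.sameDivisor_zero_of_forall_ordAt_eq_zero hX fun z hz => ?_
      rw [hsame.ordAt_eq z, hNord]
      exact Finset.sum_eq_zero fun j _ => by
        have hj : (a j : ℤ) = 0 := congrFun h0 j
        rw [hj, zero_mul]
    exact hD0.symm.avoids (CartierDivisor.avoids_zero x₀)
  -- NEGATIVE DEFINITENESS (du Val, Lipman (14.1) — a theorem of the tree)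
  have h141 := Lipman1969_14_1_holds T hdim X π hπ F hF hc (fun j => (a j : ℤ)) ha0
  have hsum : ∑ i : {η // η ∈ F}, ∑ j, (a i : ℤ) * (a j : ℤ) *
      excCurveDegree π (CartierDivisor.ofIsEffectiveCartier (primeDivisorIdeal (j : X)) (hc j j.2)) i =
      ∑ i : {η // η ∈ F}, (a i : ℤ) * excCurveDegree π D i := by
    refine Finset.sum_congr rfl fun i _ => ?_
    rw [hdegD i, Finset.mul_sum]
    refine Finset.sum_congr rfl fun j _ => ?_
    change (a i : ℤ) * (a j : ℤ) * excCurveDegree π (E j) i = _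
    ring
  rw [hsum] at h141
  -- some term `a_i (D·E_i)` is negative: `a_i > 0` and `(D·E_i) < 0`
  by_contra hcon
  push Not at hcon
  have hnn : 0 ≤ ∑ i : {η // η ∈ F}, (a i : ℤ) * excCurveDegree π D i := by
    refine Finset.sum_nonneg fun i _ => ?_
    by_cases hai : a i = 0
    · rw [hai, Nat.cast_zero, zero_mul]
    · have hpos : 0 < D.ordAt i := by
        rw [← haZ i]
        exact_mod_cast Nat.pos_of_ne_zero hai
      exact mul_nonneg (Nat.cast_nonneg _) (hcon i (hη i) hpos)
  exact absurd h141 (not_lt.mpr hnn)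

/-- **Chart-language form**: the hypotheses on `D ≥ 0` phrased with its local equations — `f_i` is a unit at every
point of `U_i` off the closed fibre, and a non-unit at some point of some `U_i`.  Conclusion as in
`exists_ordAt_pos_and_excCurveDegree_neg_of_isEffective`. [cite: Lipman1969, Lemma (14.1) (p. 224)] -/
theorem exists_ordAt_pos_and_excCurveDegree_neg_of_charts (hdim : ringKrullDim T = 2) (hπ : IsResolution π)
    (D : CartierDivisor X) (hD : D.IsEffective)
    (hoff : ∀ (i : D.ι) (x : X), x ∈ D.U i → π.base x ≠ closedPoint T → IsUnitAt x (D.f i))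
    (hx₀ : ∃ (i : D.ι) (x₀ : X), x₀ ∈ D.U i ∧ ¬ IsUnitAt x₀ (D.f i)) :
    ∃ η ∈ excCurvePoints π, 0 < D.ordAt η ∧ excCurveDegree π D η < 0 := by
  refine exists_ordAt_pos_and_excCurveDegree_neg_of_isEffective hdim hπ D hD
    (fun x hx i hi => hoff i x hi hx) ?_
  obtain ⟨i, x₀, hi, hu⟩ := hx₀
  exact ⟨x₀, fun hav => hu (hav i hi)⟩

end Literature.AlgebraicGeometry.Resolution

end
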